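import Mathlib
import HarnessLib

/-!
# NE7SecondOrderChainRule — SECOND DERIVATIVES OF COMPOSITIONS (the calculus letters for the Hessian of the constrained minimal action, ROAD-G115 §2)

Pure calculus over real normed spaces ([folklore]; 0 def, 0 sorry): for `f : S → ℝ` and `Θ : E → S` both `C²`,
`D²(f∘Θ)(x)[u,u′] = D²f(Θx)[DΘ(x)u, DΘ(x)u′] + Df(Θx)[D²Θ(x)[u,u′]]` (**`fderiv_fderiv_comp`**); hence at a CRITICAL point of `f` the curvature of `Θ` drops out
(**`fderiv_fderiv_comp_of_fderiv_eq_zero`**), and along a continuous linear map `ℓ` one has `D²(f∘ℓ)(x)[u,u′] = D²f(ℓx)[ℓu, ℓu′]` (**`fderiv_fderiv_comp_clm`**); linearity of the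
second derivative in the function (**`fderiv_fderiv_const_mul_sub`**).  MECHANISM: `fderiv (f∘Θ) = (Df∘Θ).comp (DΘ)` near `x` and the product rule `HasFDerivAt.clm_comp`.
Cell `pub-balaban`, rung (B)+1 sub-cell t4, lineage `b2b-balaban-t4-ne7-p1` (CRUX PROVER NE7 #1 = OWNER of BINDER row NE7), generation 115.  Memo `t4/b2b-balaban-t4-ne7-p1-g115/ROAD-G115.md` §2.
HONEST FRAMING (page 1): a calculus letter; nothing of Bałaban's asserted; NOT NE7, NOT NE3; spine 0∕9; NOT infinite volume, NOT mass gap, NOT BetaPertH, NOT Clay.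
-/

set_option autoImplicit false

open scoped Topology
open Filter Set ContinuousLinearMap

namespace Summit.QuantumFields.BalabanUV.T4Continuum.NE7SecondOrderChainRule

variable {E S : Type*} [NormedAddCommGroup E] [NormedSpace ℝ E] [NormedAddCommGroup S] [NormedSpace ℝ S]

/-- **SECOND-ORDER CHAIN RULE**: for `f : S → ℝ` `C²` at `Θ x` and `Θ : E → S` `C²` at `x`,
`D²(f∘Θ)(x)[u,u′] = D²f(Θ x)[DΘ(x)u, DΘ(x)u′] + Df(Θ x)[D²Θ(x)[u,u′]]`. [folklore] -/
theorem fderiv_fderiv_comp {f : S → ℝ} {Θ : E → S} {x : E} (hf : ContDiffAt ℝ 2 f (Θ x)) (hΘ : ContDiffAt ℝ 2 Θ x) (u u' : E) :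
    fderiv ℝ (fderiv ℝ (fun y : E => f (Θ y))) x u u'
      = fderiv ℝ (fderiv ℝ f) (Θ x) (fderiv ℝ Θ x u) (fderiv ℝ Θ x u') + fderiv ℝ f (Θ x) (fderiv ℝ (fderiv ℝ Θ) x u u') := by
  have hΘd : ∀ᶠ y : E in 𝓝 x, DifferentiableAt ℝ Θ y :=
    (hΘ.eventually (by simp)).mono fun y hy => hy.differentiableAt (by simp)
  have hfd' : ∀ᶠ s : S in 𝓝 (Θ x), DifferentiableAt ℝ f s :=
    (hf.eventually (by simp)).mono fun s hs => hs.differentiableAt (by simp)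
  have hfd : ∀ᶠ y : E in 𝓝 x, DifferentiableAt ℝ f (Θ y) := hΘ.continuousAt.eventually hfd'
  have hev : fderiv ℝ (fun y : E => f (Θ y)) =ᶠ[𝓝 x] fun y : E => (fderiv ℝ f (Θ y)).comp (fderiv ℝ Θ y) := by
    filter_upwards [hΘd, hfd] with y hΘy hfy
    exact fderiv_comp y hfy hΘy
  have hc : HasFDerivAt (fun y : E => fderiv ℝ f (Θ y)) ((fderiv ℝ (fderiv ℝ f) (Θ x)).comp (fderiv ℝ Θ x)) x :=
    ((hf.fderiv_right (by norm_num)).differentiableAt one_ne_zero).hasFDerivAt.comp x (hΘ.differentiableAt (by simp)).hasFDerivAt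
  have hd : HasFDerivAt (fun y : E => fderiv ℝ Θ y) (fderiv ℝ (fderiv ℝ Θ) x) x :=
    ((hΘ.fderiv_right (by norm_num)).differentiableAt one_ne_zero).hasFDerivAt
  rw [hev.fderiv_eq, (hc.clm_comp hd).fderiv]
  simp only [add_apply, ContinuousLinearMap.comp_apply, compL_apply, flip_apply]
  ring

/-- **AT A CRITICAL POINT THE CURVATURE OF THE INNER MAP DROPS OUT**: if moreover `Df(Θ x) = 0` then `D²(f∘Θ)(x)[u,u′] = D²f(Θ x)[DΘ(x)u, DΘ(x)u′]`. [folklore] -/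
theorem fderiv_fderiv_comp_of_fderiv_eq_zero {f : S → ℝ} {Θ : E → S} {x : E} (hf : ContDiffAt ℝ 2 f (Θ x)) (hΘ : ContDiffAt ℝ 2 Θ x)
    (h0 : fderiv ℝ f (Θ x) = 0) (u u' : E) :
    fderiv ℝ (fderiv ℝ (fun y : E => f (Θ y))) x u u' = fderiv ℝ (fderiv ℝ f) (Θ x) (fderiv ℝ Θ x u) (fderiv ℝ Θ x u') := by
  rw [fderiv_fderiv_comp hf hΘ, h0, zero_apply, add_zero]

/-- **SECOND DERIVATIVE ALONG A CONTINUOUS LINEAR MAP**: `D²(f∘ℓ)(x)[u,u′] = D²f(ℓ x)[ℓ u, ℓ u′]`. [folklore] -/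
theorem fderiv_fderiv_comp_clm {f : S → ℝ} (ℓ : E →L[ℝ] S) {x : E} (hf : ContDiffAt ℝ 2 f (ℓ x)) (u u' : E) :
    fderiv ℝ (fderiv ℝ (fun y : E => f (ℓ y))) x u u' = fderiv ℝ (fderiv ℝ f) (ℓ x) (ℓ u) (ℓ u') := by
  rw [fderiv_fderiv_comp hf ℓ.contDiff.contDiffAt, ℓ.fderiv]
  have h2 : fderiv ℝ (fderiv ℝ (⇑ℓ : E → S)) x = 0 := by
    have h : fderiv ℝ (⇑ℓ : E → S) = fun _ : E => ℓ := by funext y; exact ℓ.fderiv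
    rw [h, fderiv_const_apply]
  rw [h2, zero_apply, zero_apply, map_zero, add_zero]

/-- **LINEARITY OF THE SECOND DERIVATIVE IN THE FUNCTION**: for `f`, `m : E → ℝ` `C²` at `x` and `w : ℝ`,
`D²(w·f − m)(x)[u,u′] = w·D²f(x)[u,u′] − D²m(x)[u,u′]`. [folklore] -/
theorem fderiv_fderiv_const_mul_sub {f m : E → ℝ} {x : E} (hf : ContDiffAt ℝ 2 f x) (hm : ContDiffAt ℝ 2 m x) (w : ℝ) (u u' : E) :
    fderiv ℝ (fderiv ℝ (fun y : E => w * f y - m y)) x u u' = w * fderiv ℝ (fderiv ℝ f) x u u' - fderiv ℝ (fderiv ℝ m) x u u' := by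
  have hfd : ∀ᶠ y : E in 𝓝 x, DifferentiableAt ℝ f y := (hf.eventually (by simp)).mono fun y hy => hy.differentiableAt (by simp)
  have hmd : ∀ᶠ y : E in 𝓝 x, DifferentiableAt ℝ m y := (hm.eventually (by simp)).mono fun y hy => hy.differentiableAt (by simp)
  have hev : fderiv ℝ (fun y : E => w * f y - m y) =ᶠ[𝓝 x] fun y : E => w • fderiv ℝ f y - fderiv ℝ m y := by
    filter_upwards [hfd, hmd] with y hfy hmy
    have h1 : HasFDerivAt (fun y : E => w * f y - m y) (w • fderiv ℝ f y - fderiv ℝ m y) y := (hfy.hasFDerivAt.const_mul w).sub hmy.hasFDerivAt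
    exact h1.fderiv
  have hF : DifferentiableAt ℝ (fderiv ℝ f) x := ((hf.fderiv_right (by norm_num)).differentiableAt one_ne_zero)
  have hM : DifferentiableAt ℝ (fderiv ℝ m) x := ((hm.fderiv_right (by norm_num)).differentiableAt one_ne_zero)
  have h2 : HasFDerivAt (fun y : E => w • fderiv ℝ f y - fderiv ℝ m y) (w • fderiv ℝ (fderiv ℝ f) x - fderiv ℝ (fderiv ℝ m) x) x :=
    (hF.hasFDerivAt.const_smul w).sub hM.hasFDerivAt
  rw [hev.fderiv_eq, h2.fderiv]
  simp only [sub_apply, FunLike.coe_smul, Pi.smul_apply, smul_eq_mul]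

end Summit.QuantumFields.BalabanUV.T4Continuum.NE7SecondOrderChainRule
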